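import Summits.Ventures.Crystal3D.Theorems.StickyWulffConstantGenericWallFloorPayerLocation
import Summits.Ventures.Crystal3D.Theorems.StickyWulffConstantGenericWallFloorDozenRigidity
import Summits.Ventures.Crystal3D.Theorems.StickyWulffConstantGenericWallFloorSharedTriangle
import HarnessLib

/-!
# A coherent walk cannot end inside the top window unless its frame is the top grain's

HONEST FRAMING. Venture `Summits/Ventures/Crystal3D` (cell `crystal3d-full`), helper for the crux
`GenericWallFloor` (stmt-Ventures-19480) of `route-Ventures-StickyWulffConstant`, REGISTERED line `WallLedgerG`,
open stub `stub_twoSlabAdhesion` (general fillings; coherent-walk engine, memos LINES-FLOOR-ARCH v3/v4 on the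
item).  Rung credit only; F-C1 not moved.

The walk invariant of `…DozenStep` is «ball `y ∈ X` with three linearly independent exact `F`-slot
neighbours».  `movedFcc_eq_of_exact_neighbours_top`: if such a ball lies deep inside the top clamped window
(`y₂ ≥ h + R₀ + 2`, lateral radius `≤ ρ − 2`) then `F(Λ₀) = A₂(Λ₀)` — the ball and its three neighbours are
sample balls by slab sealing (`mem_sample_top_of_deep`), so the three slots are unit vectors of `A₂·Λ₀` and
dozen rigidity (`movedFcc_eq_of_three_independent_units`, crystal3d-wulff-p2) pins the lattice.  Along a walk
the frame only changes by mirrors `F ↦ (x ↦ F x − 2⟪F x, n⟫ n)` across `{111}` planes of `F`; for a pair whose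
top lattice `A₂(Λ₀)` is not in the mirror-closed class of `A₁` («non-chain pair», stated WITHOUT a new
definition as: some set `𝓕` of frames contains `A₁`, is closed under such mirrors, and avoids `A₂(Λ₀)`) a
walk started on the bottom grain therefore never reaches the deep top window: `not_deep_top_of_frame_mem`.
WHAT THIS IS NOT: not the stub; no walk is constructed here; F-C1 not moved.
-/

noncomputable section

namespace Summit.Ventures.Crystal3D.Theorems

open Summit.Ventures.Crystal3D Finset
open Literature.MathematicalPhysics.StatisticalMechanics (fccStacking)
open scoped InnerProductSpace

/-- **Deep in the top window the frame is the top grain's.** -/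
theorem movedFcc_eq_of_exact_neighbours_top
    (A₂ : EuclideanSpace ℝ (Fin 3) ≃ₗᵢ[ℝ] EuclideanSpace ℝ (Fin 3)) (t₂ : EuclideanSpace ℝ (Fin 3))
    (X P₂ : Finset (EuclideanSpace ℝ (Fin 3))) (R₀ h ρ : ℝ) (hR₀ : 3 ≤ R₀) (hρ : R₀ ≤ ρ)
    (hX : ∀ p ∈ X, ∀ q ∈ X, p ≠ q → 1 ≤ dist p q) (hP₂X : P₂ ⊆ X)
    (hcell : ∀ p ∈ X, p 2 ≤ h + 2 * R₀)
    (hP₂ : ∀ p, p ∈ P₂ ↔ (p ∈ (fun q => A₂ q + t₂) '' fccStacking 1 (Real.sqrt (2 / 3)) ∧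
      h + R₀ ≤ p 2 ∧ p 2 ≤ h + 2 * R₀ ∧ p 0 ^ 2 + p 1 ^ 2 ≤ ρ ^ 2))
    (hclean₂ : ∀ p ∈ X, h + 2 * R₀ - 1 < p 2 → p ∈ (fun q => A₂ q + t₂) '' fccStacking 1 (Real.sqrt (2 / 3)))
    (F : EuclideanSpace ℝ (Fin 3) ≃ₗᵢ[ℝ] EuclideanSpace ℝ (Fin 3)) {y : EuclideanSpace ℝ (Fin 3)} (hy : y ∈ X)
    (hy2 : h + R₀ + 2 ≤ y 2) (hyr : y 0 ^ 2 + y 1 ^ 2 ≤ (ρ - 2) ^ 2)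
    {a b c : EuclideanSpace ℝ (Fin 3)} (ha : a ∈ fccSlots) (hb : b ∈ fccSlots) (hc : c ∈ fccSlots)
    (hind : LinearIndependent ℝ ![a, b, c])
    (haX : y + F a ∈ X) (hbX : y + F b ∈ X) (hcX : y + F c ∈ X) :
    F '' fccStacking 1 (Real.sqrt (2 / 3)) = A₂ '' fccStacking 1 (Real.sqrt (2 / 3)) := by
  set Λ₂ : Set (EuclideanSpace ℝ (Fin 3)) := (fun q => A₂ q + t₂) '' fccStacking 1 (Real.sqrt (2 / 3)) with hΛ₂
  have hρ2 : (0 : ℝ) ≤ ρ - 2 := by linarith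
  -- slab sealing: deep balls are sample balls, hence on `Λ₂`
  have hseal : ∀ q ∈ X, h + R₀ + 1 ≤ q 2 → q 0 ^ 2 + q 1 ^ 2 ≤ (ρ - 1) ^ 2 → q ∈ Λ₂ := fun q hq hq2 hqr =>
    ((hP₂ q).1 (mem_sample_top_of_deep A₂ t₂ X P₂ R₀ h ρ hR₀ hρ hX hP₂X hcell hP₂ hclean₂ hq hq2 hqr)).1
  have hyΛ : y ∈ Λ₂ := hseal y hy (by linarith) (hyr.trans (by nlinarith : (ρ - 2) ^ 2 ≤ (ρ - 1) ^ 2))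
  have nbΛ : ∀ {w}, w ∈ fccSlots → y + F w ∈ X → y + F w ∈ Λ₂ := by
    intro w hw hwX
    have hn1 : ‖F w‖ = 1 := by rw [LinearIsometryEquiv.norm_map, norm_eq_one_of_mem_fccSlots hw]
    apply hseal _ hwX
    · have h1 := abs_apply_sub_le_dist (y + F w) y 2
      rw [dist_eq_norm, add_sub_cancel_left, hn1] at h1
      have := (abs_le.1 h1).1
      linarith
    · have := lateral_sq_add_le y (F w) hρ2 hyr
      rw [hn1] at this
      convert this using 2; ring
  have slotΛ : ∀ {w}, w ∈ fccSlots → y + F w ∈ X → F w ∈ A₂ '' fccStacking 1 (Real.sqrt (2 / 3)) := by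
    intro w hw hwX
    have := sub_mem_image_of_mem_affine A₂ t₂ _ _ (nbΛ hw hwX) hyΛ
    rwa [add_sub_cancel_left] at this
  exact movedFcc_eq_of_three_independent_units F A₂
    ⟨a, mem_fcc_of_mem_fccSlots ha, rfl⟩ ⟨b, mem_fcc_of_mem_fccSlots hb, rfl⟩ ⟨c, mem_fcc_of_mem_fccSlots hc, rfl⟩
    (slotΛ ha haX) (slotΛ hb hbX) (slotΛ hc hcX)
    (by rw [LinearIsometryEquiv.norm_map, norm_eq_one_of_mem_fccSlots ha])
    (by rw [LinearIsometryEquiv.norm_map, norm_eq_one_of_mem_fccSlots hb])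
    (by rw [LinearIsometryEquiv.norm_map, norm_eq_one_of_mem_fccSlots hc])
    (linearIndependent_map_triple F hind)

/-- **Non-chain pairs: a walk state never lies deep in the top window.**  `𝓕` is any set of frames
avoiding the top lattice (`G(Λ₀) ≠ A₂(Λ₀)` for `G ∈ 𝓕`); a state with frame `F ∈ 𝓕` deep inside the top
window is contradictory.  (Take for `𝓕` the mirror-closed class of `A₁`: it contains every frame a walk
started on the bottom grain can carry.) -/
theorem not_deep_top_of_frame_mem
    (A₂ : EuclideanSpace ℝ (Fin 3) ≃ₗᵢ[ℝ] EuclideanSpace ℝ (Fin 3)) (t₂ : EuclideanSpace ℝ (Fin 3))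
    (X P₂ : Finset (EuclideanSpace ℝ (Fin 3))) (R₀ h ρ : ℝ) (hR₀ : 3 ≤ R₀) (hρ : R₀ ≤ ρ)
    (hX : ∀ p ∈ X, ∀ q ∈ X, p ≠ q → 1 ≤ dist p q) (hP₂X : P₂ ⊆ X)
    (hcell : ∀ p ∈ X, p 2 ≤ h + 2 * R₀)
    (hP₂ : ∀ p, p ∈ P₂ ↔ (p ∈ (fun q => A₂ q + t₂) '' fccStacking 1 (Real.sqrt (2 / 3)) ∧
      h + R₀ ≤ p 2 ∧ p 2 ≤ h + 2 * R₀ ∧ p 0 ^ 2 + p 1 ^ 2 ≤ ρ ^ 2))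
    (hclean₂ : ∀ p ∈ X, h + 2 * R₀ - 1 < p 2 → p ∈ (fun q => A₂ q + t₂) '' fccStacking 1 (Real.sqrt (2 / 3)))
    (𝓕 : Set (EuclideanSpace ℝ (Fin 3) ≃ₗᵢ[ℝ] EuclideanSpace ℝ (Fin 3)))
    (havoid : ∀ G ∈ 𝓕, G '' fccStacking 1 (Real.sqrt (2 / 3)) ≠ A₂ '' fccStacking 1 (Real.sqrt (2 / 3)))
    {F : EuclideanSpace ℝ (Fin 3) ≃ₗᵢ[ℝ] EuclideanSpace ℝ (Fin 3)} (hF : F ∈ 𝓕)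
    {y : EuclideanSpace ℝ (Fin 3)} (hy : y ∈ X)
    (hy2 : h + R₀ + 2 ≤ y 2) (hyr : y 0 ^ 2 + y 1 ^ 2 ≤ (ρ - 2) ^ 2)
    {a b c : EuclideanSpace ℝ (Fin 3)} (ha : a ∈ fccSlots) (hb : b ∈ fccSlots) (hc : c ∈ fccSlots)
    (hind : LinearIndependent ℝ ![a, b, c])
    (haX : y + F a ∈ X) (hbX : y + F b ∈ X) (hcX : y + F c ∈ X) : False :=
  havoid F hF (movedFcc_eq_of_exact_neighbours_top A₂ t₂ X P₂ R₀ h ρ hR₀ hρ hX hP₂X hcell hP₂ hclean₂ F hy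
    hy2 hyr ha hb hc hind haX hbX hcX)

end Summit.Ventures.Crystal3D.Theorems

end
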